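import Literature.NumberTheory.Sieve.LinearEquationsInPrimesPseudorandom
import Literature.NumberTheory.Sieve.LinearEquationsInPrimesSieveTau
import Literature.NumberTheory.LFunctions.KloostermanPrimePower
import HarnessLib

/-!
# The enveloping sieve: the weight `τ` of the correlation condition and its moments (Green–Tao 2010, App. D)

Trunk T-SIEVE (`Literature/NumberTheory/Sieve`). Part of the App. D layer of the decomposition of
`Literature.NumberTheory.Sieve.GreenTaoZiegler2012_finiteComplexity`, towards the verification of
the correlation condition (Def. 6.3) for Green–Tao's enveloping-sieve measure
(B. Green, T. Tao, *Linear equations in primes*, Ann. of Math. 171 (2010), App. D, proof of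
Prop. 6.4, p. 48 of arXiv:math/0606088: "It follows from this analysis that if we set
`τ(n) := ∑_{1 ≤ j < j' ≤ m} exp(O(∑_{p > w, p | Wn + b_{i_j} - b_{i_{j'}}} p^{-1/2}))` then we obtain the
desired correlation estimate. To show the moment bounds on `τ` it suffices to show that
`𝔼_{n ∈ [N]} exp(q ∑_{p > w, p | Wn + h} p^{-1/2}) ≪_q 1` for all `h = O(W)`.").

The weight lives on `ℤ_{N'}` (Def. 6.3), a residue `x` standing for the integers `x̃ + ℓ N'`,
`ℓ ∈ {-2, -1, 0, 1}`, `x̃ ∈ [0, N')` its representative (these are the values of a difference of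
two DISTINCT shifts unwrapped to `[N]`). This file supplies the distinct-shifts part `e(x)` of `τ`
(`corrPairWeight`) and the arithmetic of its moment bounds, all PROVED; the coincident-shift term
`τ(0)` ("moderately large", by crude divisor estimates) and the constant term are added by the
consumer `…EnvelopingSieveCorrelations.lean` (`τ = 2^D + 1_{x=0} T₀ + T₁ e`):

* `Literature.NumberTheory.Sieve.roughSum w m = ∑_{p > w, p | m} p^{-1/2}` and the cutoff
  raising `roughSum w m ≤ (w' - w) + roughSum w' m` (`roughSum_le_sub_add`), whence
  `exp(q · roughSum w m) ≤ exp(q w_q) · ∏_{p > w', p | m}(1 + p^{-1/4})` for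
  `w' = max(w, w_q)`, `w_q = ⌈(2q)^4⌉` (`exp_mul_roughSum_le`): the printed argument needs
  `w ≥ (2q)^4` ("for `p ≥ C(q)`"), and `q` is arbitrary in Def. 6.3, so the primes between `w`
  and `(2q)^4` are paid for by the constant `exp(q w_q)`;
* the rough weight is at most the number itself (`roughWeight_le_self`), used for the one
  boundary term of each unwrapped family;
* `Literature.NumberTheory.Sieve.sum_exp_roughSum_window_le` — the window moment
  `∑_{0 ≤ n ≤ M} exp(q · roughSum w (Wn + h)) ≤ exp(q w_q) (h + 5M + (4/3)(WM + h)^{3/4})`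
  (the tree's `sum_roughWeight_le_linear`, App. D's "`∑_{(d,W)=1, d = O(WN)} d^{-1/4} ∑ 1 ≪ N`");
* `Literature.NumberTheory.Sieve.sum_exp_roughSum_lift_le` — the moment of one unwrapped family
  `∑_{x̃ < N'} exp(q · roughSum w |W(x̃ + ℓN') + Δ|) ≤ 24 exp(q w_q) N'` for `|Δ| < W`,
  `W ≤ N'`, `W³ ≤ 27 N'`;
* `Literature.NumberTheory.Sieve.primorial_pow_three_le` — `W³ ≤ 27 N` for `W = ∏_{p ≤ w} p`,
  `w ≤ ½ log log N` ("since `w = O(log log N)` is so small");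
* generic inequalities for the sibling `…Proofs` layer: the product bound `∏_{i < m} aᵢ ≤ 𝔼_i aᵢ^m`
  (`prod_le_avg_pow`, AM–GM) and `(1 + log N)^a ≤ (1 + a)^a N` (`one_add_log_rpow_le`); the power
  mean `(∑ aᵢ)^q ≤ #s^{q-1} ∑ aᵢ^q` is Mathlib's `Real.rpow_sum_le_const_mul_sum_rpow_of_nonneg`, and
  sums over `ℤ_{N'}` are unwrapped with the tree's `Literature.NumberTheory.LFunctions.sum_zmod_eq_sum_range`.

## References

* B. Green, T. Tao, *Linear equations in primes*, Ann. of Math. (2) 171 (2010), 1753–1850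
  (arXiv:math/0606088), Def. 6.3 and App. D (end of the proof of Prop. 6.4).
* B. Green, T. Tao, *The primes contain arbitrarily long arithmetic progressions*, Ann. of
  Math. (2) 167 (2008), Lemma 9.10 and the proof of Prop. 9.6, for comparison.
-/

noncomputable section

open Finset

namespace Literature.NumberTheory.Sieve

/-! ### Generic inequalities -/

/-- Products by powers: `∏_{i} aᵢ ≤ (1/m) ∑_i aᵢ^m` for `aᵢ ≥ 0` on `Fin m`, `m ≥ 1` (AM–GM).
[folklore] -/
theorem prod_le_avg_pow {m : ℕ} (hm : 1 ≤ m) {a : Fin m → ℝ} (ha : ∀ i, 0 ≤ a i) :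
    ∏ i, a i ≤ (1 / (m : ℝ)) * ∑ i, a i ^ m := by
  have hm0 : (0 : ℝ) < m := by exact_mod_cast hm
  have h := Real.geom_mean_le_arith_mean_weighted (Finset.univ : Finset (Fin m))
    (fun _ => 1 / (m : ℝ)) (fun i => a i ^ m) (fun _ _ => by positivity)
    (by rw [Finset.sum_const, Finset.card_univ, Fintype.card_fin, nsmul_eq_mul]; field_simp)
    (fun i _ => pow_nonneg (ha i) m)
  have hl : ∏ i, (a i ^ m) ^ (1 / (m : ℝ)) = ∏ i, a i := by
    refine Finset.prod_congr rfl fun i _ => ?_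
    rw [← Real.rpow_natCast, ← Real.rpow_mul (ha i)]
    field_simp
    exact Real.rpow_one _
  rw [hl, ← Finset.mul_sum] at h
  exact h

/-- `(1 + log N)^a ≤ (1 + a)^a N` for `N ≥ 1`, `a ≥ 0` (from `log N ≤ a N^{1/a}`).
[folklore] -/
theorem one_add_log_rpow_le {N : ℝ} (hN : 1 ≤ N) {a : ℝ} (ha : 0 ≤ a) :
    (1 + Real.log N) ^ a ≤ (1 + a) ^ a * N := by
  have hlog : 0 ≤ Real.log N := Real.log_nonneg hN
  rcases ha.eq_or_lt with rfl | ha0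
  · simp only [Real.rpow_zero, one_mul]; exact hN
  -- `1 + log N ≤ (1 + a) N^{1/a}`
  have hu1 : 1 ≤ N ^ (1 / a) := Real.one_le_rpow hN (by positivity)
  have hkey : 1 + Real.log N ≤ (1 + a) * N ^ (1 / a) := by
    have h1 : Real.log N ≤ N ^ (1 / a) / (1 / a) := Real.log_le_rpow_div (by linarith) (by positivity)
    rw [div_div_eq_mul_div, div_one] at h1
    nlinarith
  calc (1 + Real.log N) ^ a ≤ ((1 + a) * N ^ (1 / a)) ^ a :=
        Real.rpow_le_rpow (by linarith) hkey ha
    _ = (1 + a) ^ a * N := by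
        rw [Real.mul_rpow (by linarith) (by positivity), ← Real.rpow_mul (by linarith)]
        rw [one_div, inv_mul_cancel₀ ha0.ne', Real.rpow_one]

/-! ### The size of `W` ("`w = O(log log N)` is so small") -/

/-- `log 2 < 1`. [folklore] -/
private theorem log_two_lt_one : Real.log 2 < 1 := by
  have := Real.log_two_lt_d9; linarith

/-- For a cutoff `w ≤ ½ log log N`: `W³ ≤ 27 N` for `W = ∏_{p ≤ w} p` (`W ≤ 4^w ≤ (log N)^{log 2}`,
and `(log N)^{3 log 2} ≤ (log N)^3 ≤ 27 N` by `log N ≤ 3 N^{1/3}`; for `log N < 1` the cutoff is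
`0`). [cite: GreenTao2010, App. D (proof of Prop. 6.4: "since `w = O(log log N)` is so small")] -/
theorem primorial_pow_three_le {N w : ℕ} (hN : 1 ≤ N) (hw : (w : ℝ) ≤ Real.log (Real.log N) / 2) :
    ((primorial w : ℝ)) ^ 3 ≤ 27 * N := by
  have hN1 : (1 : ℝ) ≤ N := by exact_mod_cast hN
  have hN0 : (0 : ℝ) < N := by linarith
  by_cases hlog : Real.log N < 1
  · -- then `log log N < 0`, so `w = 0`
    have hll : Real.log (Real.log N) ≤ 0 := Real.log_nonpos (Real.log_nonneg hN1) hlog.le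
    have hw0 : w = 0 := by
      have : (w : ℝ) ≤ 0 := hw.trans (by linarith)
      exact Nat.cast_nonpos.mp this
    subst hw0
    have hp0 : primorial 0 = 1 := by
      simp [primorial, Finset.filter_singleton, Nat.not_prime_zero]
    rw [hp0]
    norm_num
    linarith
  · push Not at hlog
    have hlogpos : 0 < Real.log N := by linarith
    -- `W ≤ 4^w = exp(w log 4) ≤ exp(log 2 · log log N) = (log N)^{log 2} ≤ log N`
    have hW : (primorial w : ℝ) ≤ Real.log N := by
      have h1 : (primorial w : ℝ) ≤ (4 : ℝ) ^ (w : ℝ) := by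
        rw [Real.rpow_natCast]; exact_mod_cast primorial_le_four_pow w
      have h2 : (4 : ℝ) ^ (w : ℝ) ≤ (4 : ℝ) ^ (Real.log (Real.log N) / 2) :=
        Real.rpow_le_rpow_of_exponent_le (by norm_num) hw
      have h3 : (4 : ℝ) ^ (Real.log (Real.log N) / 2) = (Real.log N) ^ (Real.log 2) := by
        rw [show (4 : ℝ) = 2 ^ (2 : ℝ) by norm_num, ← Real.rpow_mul (by norm_num),
          show (2 : ℝ) * (Real.log (Real.log N) / 2) = Real.log (Real.log N) by ring,
          Real.rpow_def_of_pos (by norm_num : (0:ℝ) < 2), Real.rpow_def_of_pos hlogpos, mul_comm]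
      have h4 : (Real.log N) ^ (Real.log 2) ≤ (Real.log N) ^ (1 : ℝ) :=
        Real.rpow_le_rpow_of_exponent_le hlog log_two_lt_one.le
      rw [Real.rpow_one] at h4
      linarith
    -- `log N ≤ 3 N^{1/3}`
    have hlog3 : Real.log N ≤ 3 * (N : ℝ) ^ (1 / 3 : ℝ) := by
      have := Real.log_le_rpow_div hN0.le (by norm_num : (0:ℝ) < 1 / 3)
      linarith [this]
    have hP0 : 0 ≤ (primorial w : ℝ) := Nat.cast_nonneg _
    calc (primorial w : ℝ) ^ 3 ≤ (Real.log N) ^ 3 := by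
          exact pow_le_pow_left₀ hP0 hW 3
      _ ≤ (3 * (N : ℝ) ^ (1 / 3 : ℝ)) ^ 3 := pow_le_pow_left₀ hlogpos.le hlog3 3
      _ = 27 * N := by
          rw [mul_pow, ← Real.rpow_natCast ((N : ℝ) ^ (1 / 3 : ℝ)) 3, ← Real.rpow_mul hN0.le]
          norm_num

/-- `(4 W N')^{3/4} ≤ 7 N'` when `W³ ≤ 27 N'` (`(4WN')³ ≤ 64·27 N'⁴ ≤ (7N')⁴`). [folklore] -/
theorem rpow_three_quarters_le {W N' : ℝ} (hW : 0 ≤ W) (hN' : 0 ≤ N') (hW3 : W ^ 3 ≤ 27 * N') :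
    (4 * W * N') ^ (3 / 4 : ℝ) ≤ 7 * N' := by
  have h1 : (4 * W * N') ^ (3 : ℕ) ≤ (7 * N') ^ (4 : ℕ) := by
    calc (4 * W * N') ^ 3 = 64 * W ^ 3 * N' ^ 3 := by ring
      _ ≤ 64 * (27 * N') * N' ^ 3 := by gcongr
      _ = 1728 * N' ^ 4 := by ring
      _ ≤ 2401 * N' ^ 4 := by nlinarith [pow_nonneg hN' 4]
      _ = (7 * N') ^ 4 := by ring
  have h1' : (4 * W * N') ^ ((3 : ℕ) : ℝ) ≤ (7 * N') ^ ((4 : ℕ) : ℝ) := by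
    rw [Real.rpow_natCast, Real.rpow_natCast]; exact h1
  have h2 : ((4 * W * N') ^ ((3 : ℕ) : ℝ)) ^ (1 / 4 : ℝ) ≤ ((7 * N') ^ ((4 : ℕ) : ℝ)) ^ (1 / 4 : ℝ) :=
    Real.rpow_le_rpow (by positivity) h1' (by norm_num)
  rw [← Real.rpow_mul (by positivity), ← Real.rpow_mul (by positivity)] at h2
  have e1 : ((3 : ℕ) : ℝ) * (1 / 4) = 3 / 4 := by norm_num
  have e2 : ((4 : ℕ) : ℝ) * (1 / 4) = 1 := by norm_num
  rw [e1, e2, Real.rpow_one] at h2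
  exact h2

/-! ### The exponential weight and the raising of the cutoff -/

/-- `S_w(m) = ∑_{p > w, p ∣ m} p^{-1/2}`, the exponent of the weight `τ` (the sum that the tree's
`exp_sum_le_roughWeight` bounds). Junk value: `S_w(0) = 0`, since Mathlib records no prime factors
for `0` (`Nat.primeFactors 0 = ∅`); in the application the argument is a non-zero integer except in
the coincident-shift case, which the consumer treats separately ("setting `τ(0)` to be moderately
large"). [cite: GreenTao2010, App. D (proof of Prop. 6.4, definition of `τ`)] -/
def roughSum (w m : ℕ) : ℝ :=
  ∑ p ∈ roughPrimeFactors w m, (p : ℝ) ^ (-(1 / 2 : ℝ))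

/-- `S_w(m) ≥ 0`. [folklore] -/
theorem roughSum_nonneg (w m : ℕ) : 0 ≤ roughSum w m :=
  Finset.sum_nonneg fun p _ => Real.rpow_nonneg (Nat.cast_nonneg p) _

/-- The junk value `S_w(0) = 0` (no prime factors are recorded for `0`). [folklore] -/
theorem roughSum_zero (w : ℕ) : roughSum w 0 = 0 := by
  simp [roughSum, roughPrimeFactors]

/-- Raising the cutoff: `S_w(m) ≤ (w' - w) + S_{w'}(m)` for `w ≤ w'` (each of the at most `w' - w`
primes in `(w, w']` contributes at most `1`). [folklore] -/
theorem roughSum_le_sub_add {w w' : ℕ} (hww : w ≤ w') (m : ℕ) :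
    roughSum w m ≤ ((w' : ℝ) - w) + roughSum w' m := by
  classical
  unfold roughSum
  have hsplit : roughPrimeFactors w m =
      (roughPrimeFactors w m).filter (fun p => p ≤ w') ∪ roughPrimeFactors w' m := by
    ext p
    simp only [roughPrimeFactors, Finset.mem_union, Finset.mem_filter]
    constructor
    · intro ⟨hp, hwp⟩
      rcases le_or_gt p w' with h | h
      · exact Or.inl ⟨⟨hp, hwp⟩, h⟩
      · exact Or.inr ⟨hp, h⟩
    · rintro (⟨⟨hp, hwp⟩, -⟩ | ⟨hp, hw'p⟩)
      · exact ⟨hp, hwp⟩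
      · exact ⟨hp, lt_of_le_of_lt hww hw'p⟩
  have hdisj : Disjoint ((roughPrimeFactors w m).filter (fun p => p ≤ w')) (roughPrimeFactors w' m) := by
    rw [Finset.disjoint_left]
    intro p hp hp'
    have h1 : p ≤ w' := (Finset.mem_filter.mp hp).2
    have h2 : w' < p := (Finset.mem_filter.mp hp').2
    omega
  rw [hsplit, Finset.sum_union hdisj]
  -- the small primes: at most `w' - w` of them, each term `≤ 1`
  set A := (roughPrimeFactors w m).filter (fun p => p ≤ w') with hA
  suffices hAle : ∑ p ∈ A, (p : ℝ) ^ (-(1 / 2 : ℝ)) ≤ (w' : ℝ) - w by linarith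
  have hsub : A ⊆ Finset.Ioc w w' := by
    intro p hp
    obtain ⟨hp1, hp2⟩ := Finset.mem_filter.mp hp
    exact Finset.mem_Ioc.mpr ⟨(Finset.mem_filter.mp hp1).2, hp2⟩
  calc ∑ p ∈ A, (p : ℝ) ^ (-(1 / 2 : ℝ)) ≤ ∑ p ∈ A, (1 : ℝ) := by
        refine Finset.sum_le_sum fun p hp => ?_
        have hp1 : 1 ≤ p := (Nat.prime_of_mem_primeFactors
          (Finset.mem_filter.mp (Finset.mem_filter.mp hp).1).1).one_lt.le
        exact Real.rpow_le_one_of_one_le_of_nonpos (by exact_mod_cast hp1) (by norm_num)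
    _ = #A := by rw [Finset.sum_const, nsmul_eq_mul, mul_one]
    _ ≤ #(Finset.Ioc w w') := by exact_mod_cast Finset.card_le_card hsub
    _ = (w' : ℝ) - w := by rw [Nat.card_Ioc, Nat.cast_sub hww]

/-- **Raising the cutoff in the exponential weight**:
`exp(q S_w(m)) ≤ exp(q (w' - w)) ∏_{p > w', p | m} (1 + p^{-1/4})` for `w ≤ w'`, `(2q)^4 ≤ w'`
(the tree's `exp_sum_le_roughWeight` at the raised cutoff). [cite: GreenTao2010, App. D (end of
the proof of Prop. 6.4)] -/
theorem exp_mul_roughSum_le {q : ℝ} (hq : 0 ≤ q) {w w' : ℕ} (hww : w ≤ w')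
    (hw' : (2 * q) ^ 4 ≤ (w' : ℝ)) (m : ℕ) :
    Real.exp (q * roughSum w m) ≤ Real.exp (q * ((w' : ℝ) - w)) * roughWeight w' m := by
  calc Real.exp (q * roughSum w m) ≤ Real.exp (q * (((w' : ℝ) - w) + roughSum w' m)) :=
        Real.exp_le_exp.mpr (mul_le_mul_of_nonneg_left (roughSum_le_sub_add hww m) hq)
    _ = Real.exp (q * ((w' : ℝ) - w)) * Real.exp (q * roughSum w' m) := by
        rw [mul_add, Real.exp_add]
    _ ≤ Real.exp (q * ((w' : ℝ) - w)) * roughWeight w' m :=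
        mul_le_mul_of_nonneg_left (exp_sum_le_roughWeight hq hw' m) (Real.exp_pos _).le

/-- `∏_{p > w, p | m} (1 + p^{-1/4}) ≤ 2^{ω(m)} ≤ m` for `m ≥ 1`. [folklore] -/
theorem roughWeight_le_self (w : ℕ) {m : ℕ} (hm : 1 ≤ m) : roughWeight w m ≤ m := by
  have h1 : roughWeight w m ≤ (2 : ℝ) ^ #(roughPrimeFactors w m) := by
    unfold roughWeight
    rw [← Finset.prod_const]
    refine Finset.prod_le_prod (fun p _ => by positivity) fun p hp => ?_
    have hp1 : 1 ≤ p := (Nat.prime_of_mem_primeFactors (Finset.mem_filter.mp hp).1).one_lt.le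
    have : (p : ℝ) ^ (-(1 / 4 : ℝ)) ≤ 1 :=
      Real.rpow_le_one_of_one_le_of_nonpos (by exact_mod_cast hp1) (by norm_num)
    linarith
  have h2 : #(roughPrimeFactors w m) ≤ #m.primeFactors := Finset.card_le_card (Finset.filter_subset _ _)
  have h3 : 2 ^ #m.primeFactors ≤ m :=
    (Finset.pow_card_le_prod m.primeFactors id 2 fun p hp => (Nat.prime_of_mem_primeFactors hp).two_le).trans
      (Nat.le_of_dvd hm (by simpa using Nat.prod_primeFactors_dvd m))
  calc roughWeight w m ≤ (2 : ℝ) ^ #(roughPrimeFactors w m) := h1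
    _ ≤ (2 : ℝ) ^ #m.primeFactors := pow_le_pow_right₀ (by norm_num) h2
    _ ≤ m := by exact_mod_cast h3

/-- `∏_{p > w, p | 0}(…) = 1` (no prime factors are recorded for `0`). [folklore] -/
theorem roughWeight_zero (w : ℕ) : roughWeight w 0 = 1 := by
  simp [roughWeight, roughPrimeFactors]

/-- `∏_{p > w, p | m} (1 + p^{-1/4}) ≤ max(1, m)`. [folklore] -/
theorem roughWeight_le_max (w m : ℕ) : roughWeight w m ≤ max 1 (m : ℝ) := by
  rcases Nat.eq_zero_or_pos m with rfl | hm
  · rw [roughWeight_zero]; exact le_max_left _ _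
  · exact (roughWeight_le_self w hm).trans (le_max_right _ _)

/-! ### Window moments -/

/-- **The window moment**: for `1 ≤ h`, `1 ≤ M`, `W ≥ 1` with all prime factors `≤ w ≤ w'` and
`(2q)^4 ≤ w'`,
`∑_{0 ≤ n ≤ M} exp(q S_w(Wn + h)) ≤ exp(q(w' - w)) (h + 5M + (4/3)(WM + h)^{3/4})`
(the `n = 0` term by `roughWeight_le_self`, the rest by the tree's `sum_roughWeight_le_linear`).
[cite: GreenTao2010, App. D (end of the proof of Prop. 6.4)] -/
theorem sum_exp_roughSum_window_le {q : ℝ} (hq : 0 ≤ q) {w w' W h M : ℕ} (hww : w ≤ w')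
    (hw' : (2 * q) ^ 4 ≤ (w' : ℝ)) (hW : 1 ≤ W) (hh : 1 ≤ h) (hM : 1 ≤ M)
    (hWw : ∀ p, p.Prime → p ∣ W → p ≤ w) :
    ∑ n ∈ Icc 0 M, Real.exp (q * roughSum w (W * n + h)) ≤
      Real.exp (q * ((w' : ℝ) - w)) * (h + 5 * M + 4 / 3 * ((W * M + h : ℕ) : ℝ) ^ (3 / 4 : ℝ)) := by
  set E : ℝ := Real.exp (q * ((w' : ℝ) - w)) with hE
  have hE0 : 0 < E := Real.exp_pos _
  rw [Finset.Icc_eq_cons_Ioc (Nat.zero_le M), Finset.sum_cons, ← Finset.Icc_add_one_left_eq_Ioc, zero_add]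
  have h0 : Real.exp (q * roughSum w (W * 0 + h)) ≤ E * h := by
    rw [mul_zero, zero_add]
    exact (exp_mul_roughSum_le hq hww hw' h).trans
      (mul_le_mul_of_nonneg_left (roughWeight_le_self w' hh) hE0.le)
  have hrest : ∑ n ∈ Icc 1 M, Real.exp (q * roughSum w (W * n + h)) ≤
      E * (5 * M + 4 / 3 * ((W * M + h : ℕ) : ℝ) ^ (3 / 4 : ℝ)) := by
    calc ∑ n ∈ Icc 1 M, Real.exp (q * roughSum w (W * n + h))
        ≤ ∑ n ∈ Icc 1 M, E * roughWeight w' (W * n + h) :=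
          Finset.sum_le_sum fun n _ => exp_mul_roughSum_le hq hww hw' _
      _ = E * ∑ n ∈ Icc 1 M, roughWeight w' (W * n + h) := by rw [Finset.mul_sum]
      _ ≤ E * (5 * M + 4 / 3 * ((W * M + h : ℕ) : ℝ) ^ (3 / 4 : ℝ)) :=
          mul_le_mul_of_nonneg_left (sum_roughWeight_le_linear w' W h M hW hM
            fun p hp hpW => (hWw p hp hpW).trans hww) hE0.le
  calc Real.exp (q * roughSum w (W * 0 + h)) + ∑ n ∈ Icc 1 M, Real.exp (q * roughSum w (W * n + h))
      ≤ E * h + E * (5 * M + 4 / 3 * ((W * M + h : ℕ) : ℝ) ^ (3 / 4 : ℝ)) := add_le_add h0 hrest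
    _ = E * (h + 5 * M + 4 / 3 * ((W * M + h : ℕ) : ℝ) ^ (3 / 4 : ℝ)) := by ring

/-- Reindexing a sum of non-negative terms along an injection into a window. [folklore] -/
theorem sum_comp_le_sum_Icc {s : Finset ℕ} {f : ℕ → ℕ} (hf : Set.InjOn f s) {M : ℕ}
    (hfM : ∀ v ∈ s, f v ≤ M) {g : ℕ → ℝ} (hg : ∀ n, 0 ≤ g n) :
    ∑ v ∈ s, g (f v) ≤ ∑ n ∈ Icc 0 M, g n := by
  classical
  rw [← Finset.sum_image (g := f) (f := g) hf]
  refine Finset.sum_le_sum_of_subset_of_nonneg (fun n hn => ?_) fun n _ _ => hg n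
  obtain ⟨v, hv, rfl⟩ := Finset.mem_image.mp hn
  exact Finset.mem_Icc.mpr ⟨Nat.zero_le _, hfM v hv⟩

/-- The window bound, evaluated for a window of length `2N'` and a residue `h < 2W`:
`≤ 23 exp(q(w'-w)) N'` when `W ≤ N'`, `W³ ≤ 27 N'`. [folklore] -/
theorem sum_exp_roughSum_window_le' {q : ℝ} (hq : 0 ≤ q) {w w' W h N' : ℕ} (hww : w ≤ w')
    (hw' : (2 * q) ^ 4 ≤ (w' : ℝ)) (hW : 1 ≤ W) (hh : 1 ≤ h) (hh2 : h < 2 * W) (hN' : 1 ≤ N')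
    (hWw : ∀ p, p.Prime → p ∣ W → p ≤ w) (hWN : W ≤ N') (hW3 : (W : ℝ) ^ 3 ≤ 27 * N') :
    ∑ n ∈ Icc 0 (2 * N'), Real.exp (q * roughSum w (W * n + h)) ≤
      23 * Real.exp (q * ((w' : ℝ) - w)) * N' := by
  have hN'0 : (0 : ℝ) ≤ N' := Nat.cast_nonneg _
  have hW0 : (0 : ℝ) ≤ W := Nat.cast_nonneg _
  refine (sum_exp_roughSum_window_le hq hww hw' hW hh (by omega) hWw).trans ?_
  have hE0 : 0 ≤ Real.exp (q * ((w' : ℝ) - w)) := (Real.exp_pos _).le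
  have h1 : (h : ℝ) ≤ 2 * N' := by
    have : (h : ℝ) < 2 * W := by exact_mod_cast hh2
    have : (W : ℝ) ≤ N' := by exact_mod_cast hWN
    linarith
  have h2 : ((W * (2 * N') + h : ℕ) : ℝ) ^ (3 / 4 : ℝ) ≤ 7 * N' := by
    have hle : ((W * (2 * N') + h : ℕ) : ℝ) ≤ 4 * W * N' := by
      push_cast
      have : (h : ℝ) < 2 * W := by exact_mod_cast hh2
      have hW1 : (1 : ℝ) ≤ N' := by exact_mod_cast hN'
      nlinarith
    exact (Real.rpow_le_rpow (Nat.cast_nonneg _) hle (by norm_num)).trans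
      (rpow_three_quarters_le hW0 hN'0 hW3)
  have h3 : ((2 * N' : ℕ) : ℝ) = 2 * N' := by push_cast; ring
  rw [h3]
  nlinarith [mul_le_mul_of_nonneg_left h1 hE0, mul_le_mul_of_nonneg_left h2 hE0]

/-! ### Moments of one unwrapped family -/

/-- `natAbs` of an integer known to be a natural number. [folklore] -/
private theorem natAbs_eq_of_eq_natCast {z : ℤ} {n : ℕ} (h : z = n) : z.natAbs = n := by
  subst h; simp

/-- `natAbs` of an integer known to be minus a natural number. [folklore] -/
private theorem natAbs_eq_of_eq_neg_natCast {z : ℤ} {n : ℕ} (h : z = -(n : ℤ)) : z.natAbs = n := by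
  subst h; simp

/-- The residues `W ± Δ` for `|Δ| < W`: naturals in `[1, 2W)`. [folklore] -/
theorem toNat_shift_bounds {W : ℕ} {Δ : ℤ} (hΔ : |Δ| < W) :
    (((W : ℤ) + Δ).toNat : ℤ) = W + Δ ∧ 1 ≤ ((W : ℤ) + Δ).toNat ∧ ((W : ℤ) + Δ).toNat < 2 * W ∧
    (((W : ℤ) - Δ).toNat : ℤ) = W - Δ ∧ 1 ≤ ((W : ℤ) - Δ).toNat ∧ ((W : ℤ) - Δ).toNat < 2 * W := by
  obtain ⟨h1, h2⟩ := abs_lt.mp hΔ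
  have e1 : (((W : ℤ) + Δ).toNat : ℤ) = W + Δ := Int.toNat_of_nonneg (by linarith)
  have e2 : (((W : ℤ) - Δ).toNat : ℤ) = W - Δ := Int.toNat_of_nonneg (by linarith)
  refine ⟨e1, ?_, ?_, e2, ?_, ?_⟩
  · have : (1 : ℤ) ≤ (((W : ℤ) + Δ).toNat : ℤ) := by rw [e1]; linarith
    exact_mod_cast this
  · have : (((W : ℤ) + Δ).toNat : ℤ) < 2 * W := by rw [e1]; linarith
    exact_mod_cast this
  · have : (1 : ℤ) ≤ (((W : ℤ) - Δ).toNat : ℤ) := by rw [e2]; linarith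
    exact_mod_cast this
  · have : (((W : ℤ) - Δ).toNat : ℤ) < 2 * W := by rw [e2]; linarith
    exact_mod_cast this

/-- **Moment of one unwrapped family**: for a lift `ℓ ∈ {-2, -1, 0, 1}` and a residue difference
`|Δ| < W`,
`∑_{0 ≤ v < N'} exp(q S_w(|W(v + ℓ N') + Δ|)) ≤ 24 exp(q (w' - w)) N'`
(each family is a window of the progression `Wn + (W ± Δ)`, `0 ≤ n ≤ 2N'`, plus at most one
boundary term `|Δ| < W ≤ N'`). Hypotheses: `W ≥ 1` with all prime factors `≤ w ≤ w'`,
`(2q)^4 ≤ w'`, `W ≤ N'`, `W³ ≤ 27 N'`. [cite: GreenTao2010, App. D (end of the proof of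
Prop. 6.4)] -/
theorem sum_exp_roughSum_lift_le {q : ℝ} (hq : 0 ≤ q) {w w' W N' : ℕ} (hww : w ≤ w')
    (hw' : (2 * q) ^ 4 ≤ (w' : ℝ)) (hW : 1 ≤ W) (hN' : 1 ≤ N')
    (hWw : ∀ p, p.Prime → p ∣ W → p ≤ w) (hWN : W ≤ N') (hW3 : (W : ℝ) ^ 3 ≤ 27 * N')
    {Δ : ℤ} (hΔ : |Δ| < W) {ℓ : ℤ} (hℓ : ℓ = -2 ∨ ℓ = -1 ∨ ℓ = 0 ∨ ℓ = 1) :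
    ∑ v ∈ range N', Real.exp (q * roughSum w (Int.natAbs ((W : ℤ) * (v + ℓ * N') + Δ))) ≤
      24 * Real.exp (q * ((w' : ℝ) - w)) * N' := by
  set E : ℝ := Real.exp (q * ((w' : ℝ) - w)) with hE
  have hE0 : 0 < E := Real.exp_pos _
  have hN'0 : (0 : ℝ) < N' := by exact_mod_cast hN'
  obtain ⟨ep, hp1, hp2, em, hm1, hm2⟩ := toNat_shift_bounds hΔ
  set hp : ℕ := ((W : ℤ) + Δ).toNat with hhp
  set hm : ℕ := ((W : ℤ) - Δ).toNat with hhm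
  have hg0 : ∀ (h n : ℕ), 0 ≤ Real.exp (q * roughSum w (W * n + h)) := fun _ _ => (Real.exp_pos _).le
  -- the two windows
  have hwinp := sum_exp_roughSum_window_le' hq hww hw' hW hp1 hp2 hN' hWw hWN hW3
  have hwinm := sum_exp_roughSum_window_le' hq hww hw' hW hm1 hm2 hN' hWw hWN hW3
  rcases hℓ with rfl | rfl | rfl | rfl
  · -- `ℓ = -2`: `|W(v - 2N') + Δ| = W(2N' - 1 - v) + (W - Δ)`
    have hterm : ∀ v ∈ range N', Real.exp (q * roughSum w (Int.natAbs ((W : ℤ) * (v + (-2) * N') + Δ))) =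
        Real.exp (q * roughSum w (W * (2 * N' - 1 - v) + hm)) := by
      intro v hv
      have hvN : v < N' := Finset.mem_range.mp hv
      have hnat : Int.natAbs ((W : ℤ) * (v + (-2) * N') + Δ) = W * (2 * N' - 1 - v) + hm := by
        refine natAbs_eq_of_eq_neg_natCast ?_
        have hsub : ((2 * N' - 1 - v : ℕ) : ℤ) = 2 * N' - 1 - v := by
          rw [Nat.cast_sub (by omega), Nat.cast_sub (by omega)]; push_cast; ring
        push_cast
        rw [hsub, em]
        ring
      rw [hnat]
    rw [Finset.sum_congr rfl hterm]
    calc ∑ v ∈ range N', Real.exp (q * roughSum w (W * (2 * N' - 1 - v) + hm))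
        ≤ ∑ n ∈ Icc 0 (2 * N'), Real.exp (q * roughSum w (W * n + hm)) :=
          sum_comp_le_sum_Icc (f := fun v => 2 * N' - 1 - v) (g := fun n => Real.exp (q * roughSum w (W * n + hm)))
            (fun v hv v' hv' h => by
              have := Finset.mem_range.mp (Finset.mem_coe.mp hv)
              have := Finset.mem_range.mp (Finset.mem_coe.mp hv')
              simp only at h; omega)
            (fun v _ => by omega) (hg0 hm)
      _ ≤ 23 * E * N' := hwinm
      _ ≤ 24 * E * N' := by nlinarith
  · -- `ℓ = -1`: `|W(v - N') + Δ| = W(N' - 1 - v) + (W - Δ)`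
    have hterm : ∀ v ∈ range N', Real.exp (q * roughSum w (Int.natAbs ((W : ℤ) * (v + (-1) * N') + Δ))) =
        Real.exp (q * roughSum w (W * (N' - 1 - v) + hm)) := by
      intro v hv
      have hvN : v < N' := Finset.mem_range.mp hv
      have hnat : Int.natAbs ((W : ℤ) * (v + (-1) * N') + Δ) = W * (N' - 1 - v) + hm := by
        refine natAbs_eq_of_eq_neg_natCast ?_
        have hsub : ((N' - 1 - v : ℕ) : ℤ) = N' - 1 - v := by
          rw [Nat.cast_sub (by omega), Nat.cast_sub (by omega)]; push_cast; ring
        push_cast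
        rw [hsub, em]
        ring
      rw [hnat]
    rw [Finset.sum_congr rfl hterm]
    calc ∑ v ∈ range N', Real.exp (q * roughSum w (W * (N' - 1 - v) + hm))
        ≤ ∑ n ∈ Icc 0 (2 * N'), Real.exp (q * roughSum w (W * n + hm)) :=
          sum_comp_le_sum_Icc (f := fun v => N' - 1 - v) (g := fun n => Real.exp (q * roughSum w (W * n + hm)))
            (fun v hv v' hv' h => by
              have := Finset.mem_range.mp (Finset.mem_coe.mp hv)
              have := Finset.mem_range.mp (Finset.mem_coe.mp hv')
              simp only at h; omega)
            (fun v _ => by omega) (hg0 hm)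
      _ ≤ 23 * E * N' := hwinm
      _ ≤ 24 * E * N' := by nlinarith
  · -- `ℓ = 0`: the `v = 0` term is the boundary term `|Δ| < W ≤ N'`; for `v ≥ 1`,
    -- `W v + Δ = W(v - 1) + (W + Δ)`
    rw [Finset.range_eq_Ico, Finset.sum_eq_sum_Ico_succ_bot (by omega : 0 < N')]
    have h0 : Real.exp (q * roughSum w (Int.natAbs ((W : ℤ) * ((0 : ℕ) + 0 * N') + Δ))) ≤ E * N' := by
      have hsimp : (W : ℤ) * ((0 : ℕ) + 0 * N') + Δ = Δ := by push_cast; ring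
      rw [hsimp]
      refine (exp_mul_roughSum_le hq hww hw' _).trans (mul_le_mul_of_nonneg_left ?_ hE0.le)
      refine (roughWeight_le_max w' _).trans (max_le (by exact_mod_cast hN') ?_)
      have h1 : (Δ.natAbs : ℤ) < W := by rw [Int.natCast_natAbs]; exact hΔ
      have h2 : (Δ.natAbs : ℝ) ≤ W := by exact_mod_cast h1.le
      exact h2.trans (by exact_mod_cast hWN)
    have hterm : ∀ v ∈ Finset.Ico (0 + 1) N',
        Real.exp (q * roughSum w (Int.natAbs ((W : ℤ) * ((v : ℕ) + 0 * N') + Δ))) =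
        Real.exp (q * roughSum w (W * (v - 1) + hp)) := by
      intro v hv
      have hv1 : 1 ≤ v := (Finset.mem_Ico.mp hv).1
      have hnat : Int.natAbs ((W : ℤ) * ((v : ℕ) + 0 * N') + Δ) = W * (v - 1) + hp := by
        refine natAbs_eq_of_eq_natCast ?_
        have hsub : ((v - 1 : ℕ) : ℤ) = v - 1 := by rw [Nat.cast_sub hv1]; push_cast; ring
        push_cast
        rw [hsub, ep]
        ring
      rw [hnat]
    rw [Finset.sum_congr rfl hterm]
    have hrest : ∑ v ∈ Finset.Ico (0 + 1) N', Real.exp (q * roughSum w (W * (v - 1) + hp)) ≤ 23 * E * N' :=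
      (sum_comp_le_sum_Icc (f := fun v => v - 1) (g := fun n => Real.exp (q * roughSum w (W * n + hp)))
        (fun v hv v' hv' h => by
          have := (Finset.mem_Ico.mp (Finset.mem_coe.mp hv)).1
          have := (Finset.mem_Ico.mp (Finset.mem_coe.mp hv')).1
          simp only at h; omega)
        (fun v hv => by have := (Finset.mem_Ico.mp hv).2; omega) (hg0 hp)).trans hwinp
    nlinarith
  · -- `ℓ = 1`: `W(v + N') + Δ = W(v + N' - 1) + (W + Δ)`
    have hterm : ∀ v ∈ range N', Real.exp (q * roughSum w (Int.natAbs ((W : ℤ) * (v + 1 * N') + Δ))) =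
        Real.exp (q * roughSum w (W * (v + N' - 1) + hp)) := by
      intro v hv
      have hnat : Int.natAbs ((W : ℤ) * (v + 1 * N') + Δ) = W * (v + N' - 1) + hp := by
        refine natAbs_eq_of_eq_natCast ?_
        have hsub : ((v + N' - 1 : ℕ) : ℤ) = v + N' - 1 := by
          rw [Nat.cast_sub (by omega)]; push_cast; ring
        push_cast
        rw [hsub, ep]
        ring
      rw [hnat]
    rw [Finset.sum_congr rfl hterm]
    calc ∑ v ∈ range N', Real.exp (q * roughSum w (W * (v + N' - 1) + hp))
        ≤ ∑ n ∈ Icc 0 (2 * N'), Real.exp (q * roughSum w (W * n + hp)) :=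
          sum_comp_le_sum_Icc (f := fun v => v + N' - 1) (g := fun n => Real.exp (q * roughSum w (W * n + hp)))
            (fun v hv v' hv' h => by
              have := Finset.mem_range.mp (Finset.mem_coe.mp hv)
              have := Finset.mem_range.mp (Finset.mem_coe.mp hv')
              simp only at h; omega)
            (fun v hv => by have := Finset.mem_range.mp hv; omega) (hg0 hp)
      _ ≤ 23 * E * N' := hwinp
      _ ≤ 24 * E * N' := by nlinarith

/-! ### The pair weight on `ℤ_{N'}` and its moments -/

/-- The lifts `ℓ ∈ {-2, -1, 0, 1}` of a residue difference. [folklore] -/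
def corrLiftSet : Finset ℤ := {-2, -1, 0, 1}

/-- `#{-2,-1,0,1} = 4`. [folklore] -/
theorem card_corrLiftSet : #corrLiftSet = 4 := by simp [corrLiftSet]

/-- Membership in the lift set. [folklore] -/
theorem mem_corrLiftSet {ℓ : ℤ} : ℓ ∈ corrLiftSet ↔ ℓ = -2 ∨ ℓ = -1 ∨ ℓ = 0 ∨ ℓ = 1 := by
  simp [corrLiftSet]

/-- The index set of the pair weight: lifts and ordered pairs of residues. [folklore] -/
def corrPairIndex (t : ℕ) : Finset (ℤ × (Fin t × Fin t)) := corrLiftSet ×ˢ Finset.univ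

/-- `#corrPairIndex t = 4 t²`. [folklore] -/
theorem card_corrPairIndex (t : ℕ) : #(corrPairIndex t) = 4 * t ^ 2 := by
  rw [corrPairIndex, Finset.card_product, card_corrLiftSet, Finset.card_univ, Fintype.card_prod,
    Fintype.card_fin, sq]

variable {t : ℕ}

/-- **The pair weight** `e(x) = ∑_{ℓ ∈ {-2,-1,0,1}} ∑_{r, r' ∈ [t]} exp(C · S_w(|W(x̃ + ℓ N') + b_r - b_{r'}|))`
on `ℤ_{N'}` (`x̃ ∈ [0, N')` the representative of `x`): the pair-matched, lift-summed form of
Green–Tao's `τ(n) = ∑_{j<j'} exp(O(∑_{p > w, p | Wn + b_{i_j} - b_{i_{j'}}} p^{-1/2}))` for DISTINCT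
shifts — it dominates every term the correlation display produces for a difference
`x = h_i - h_{i'} ≠ 0` of two distinct shifts unwrapped to `[N]`. It is NOT by itself the `τ` of
Def. 6.3 (which must also serve coincident shifts `h_i = h_{i'}`, "not necessarily distinct"):
`e(0)` is bounded (its `ℓ = 0`, `r = r'` term is `exp(C · S_w(0)) = 1`, junk value of `roughSum`),
whereas the source handles the coincident case by "setting `τ(0)` to be moderately large"; the
consumer (`…EnvelopingSieveCorrelations.lean`) therefore uses
`τ(x) = 2^D + 1_{x=0} T₀ + T₁ e(x)` with the crude-divisor bound `T₀`.
[cite: GreenTao2010, App. D (proof of Prop. 6.4, definition of `τ`)] -/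
def corrPairWeight (C : ℝ) (w : ℕ) (b : Fin t → ℕ) (N' : ℕ) (x : ZMod N') : ℝ :=
  ∑ k ∈ corrPairIndex t, Real.exp (C * roughSum w
    (Int.natAbs ((primorial w : ℤ) * ((x.val : ℤ) + k.1 * N') + ((b k.2.1 : ℤ) - b k.2.2))))

/-- `e(x) ≥ 0`. [folklore] -/
theorem corrPairWeight_nonneg (C : ℝ) (w : ℕ) (b : Fin t → ℕ) (N' : ℕ) (x : ZMod N') :
    0 ≤ corrPairWeight C w b N' x :=
  Finset.sum_nonneg fun _ _ => (Real.exp_pos _).le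

/-- Each term of the pair weight is at most the weight. [folklore] -/
theorem exp_le_corrPairWeight {C : ℝ} {w : ℕ} {b : Fin t → ℕ} {N' : ℕ} (x : ZMod N') {ℓ : ℤ}
    (hℓ : ℓ ∈ corrLiftSet) (r r' : Fin t) :
    Real.exp (C * roughSum w (Int.natAbs ((primorial w : ℤ) * ((x.val : ℤ) + ℓ * N') + ((b r : ℤ) - b r'))))
      ≤ corrPairWeight C w b N' x := by
  have hmem : (ℓ, (r, r')) ∈ corrPairIndex t := Finset.mem_product.mpr ⟨hℓ, Finset.mem_univ _⟩
  have h := Finset.single_le_sum (s := corrPairIndex t) (f := fun k : ℤ × (Fin t × Fin t) =>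
    Real.exp (C * roughSum w (Int.natAbs ((primorial w : ℤ) * ((x.val : ℤ) + k.1 * N') +
      ((b k.2.1 : ℤ) - b k.2.2))))) (fun _ _ => (Real.exp_pos _).le) hmem
  simpa only [corrPairWeight] using h

/-- **Moments of the pair weight** ("To show the moment bounds on `τ` it suffices to show that
`𝔼_{n ∈ [N]} exp(q ∑_{p>w, p | Wn+h} p^{-1/2}) ≪_q 1` for all `h = O(W)`"): for `q ≥ 1`,
`𝔼_{x ∈ ℤ_{N'}} e(x)^q ≤ (4t²)^q · 24 · exp(q C ⌈(2qC)^4⌉)`, uniformly in `N ≥ 2`,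
`w ≤ ½ log log N`, `N' ≥ N` and the residues `bᵢ ∈ [W]`.
[cite: GreenTao2010, App. D (end of the proof of Prop. 6.4)] -/
theorem sum_corrPairWeight_rpow_div_le {C : ℝ} (hC : 0 ≤ C) {q : ℝ} (hq : 1 ≤ q) (ht : 1 ≤ t)
    {N w N' : ℕ} [NeZero N'] (hN : 2 ≤ N) (hw : (w : ℝ) ≤ Real.log (Real.log N) / 2)
    (hNN' : N ≤ N') {b : Fin t → ℕ} (hb : ∀ i, 1 ≤ b i ∧ b i ≤ primorial w) :
    (∑ x : ZMod N', corrPairWeight C w b N' x ^ q) / N' ≤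
      (4 * (t : ℝ) ^ 2) ^ q * (24 * Real.exp (q * C * ⌈(2 * (q * C)) ^ 4⌉₊)) := by
  -- parameters
  set q' : ℝ := q * C with hq'
  have hq'0 : 0 ≤ q' := by positivity
  set wq : ℕ := ⌈(2 * q') ^ 4⌉₊ with hwq
  set w' : ℕ := max w wq with hw'def
  have hww : w ≤ w' := le_max_left _ _
  have hw' : (2 * q') ^ 4 ≤ (w' : ℝ) :=
    (Nat.le_ceil _).trans (by exact_mod_cast le_max_right w wq)
  have hdiff : (w' : ℝ) - w ≤ wq := by
    have : w' ≤ w + wq := max_le (Nat.le_add_right _ _) (Nat.le_add_left _ _)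
    have : (w' : ℝ) ≤ w + wq := by exact_mod_cast this
    linarith
  set W : ℕ := primorial w with hWdef
  have hW : 1 ≤ W := primorial_pos w
  have hN1 : 1 ≤ N := by omega
  have hN'1 : 1 ≤ N' := by omega
  have hWN : W ≤ N' := (by exact_mod_cast primorial_le_of_le_logLog hN hw : W ≤ N).trans hNN'
  have hW3 : (W : ℝ) ^ 3 ≤ 27 * N' :=
    (primorial_pow_three_le hN1 hw).trans (by exact_mod_cast Nat.mul_le_mul_left 27 hNN')
  have hWw : ∀ p, p.Prime → p ∣ W → p ≤ w := fun p hp h => hp.dvd_primorial_iff.mp h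
  have hN'0 : (0 : ℝ) < N' := by exact_mod_cast hN'1
  set E : ℝ := Real.exp (q' * ((w' : ℝ) - w)) with hEdef
  have hEle : E ≤ Real.exp (q * C * wq) := Real.exp_le_exp.mpr (by
    rw [← hq']; exact mul_le_mul_of_nonneg_left hdiff hq'0)
  -- Step 1: power mean, pointwise in `x`
  have hcardI : (#(corrPairIndex t) : ℝ) = 4 * (t : ℝ) ^ 2 := by
    rw [card_corrPairIndex]; push_cast; ring
  set a : ℤ × (Fin t × Fin t) → ZMod N' → ℝ := fun k x => Real.exp (C * roughSum w
    (Int.natAbs ((W : ℤ) * ((x.val : ℤ) + k.1 * N') + ((b k.2.1 : ℤ) - b k.2.2)))) with hadef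
  have hpm : ∀ x : ZMod N', corrPairWeight C w b N' x ^ q ≤
      (4 * (t : ℝ) ^ 2) ^ (q - 1) * ∑ k ∈ corrPairIndex t, Real.exp (q' * roughSum w
        (Int.natAbs ((W : ℤ) * ((x.val : ℤ) + k.1 * N') + ((b k.2.1 : ℤ) - b k.2.2)))) := by
    intro x
    have h := Real.rpow_sum_le_const_mul_sum_rpow_of_nonneg (corrPairIndex t) hq (f := fun k => a k x)
      (fun k _ => (Real.exp_pos _).le)
    rw [hcardI] at h
    refine h.trans (le_of_eq ?_)
    congr 1
    refine Finset.sum_congr rfl fun k _ => ?_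
    rw [hadef]
    simp only
    rw [← Real.exp_mul, hq']
    ring_nf
  -- Step 2: each family has moment `≤ 24 E N'`
  have hfam : ∀ k ∈ corrPairIndex t, ∑ x : ZMod N', Real.exp (q' * roughSum w
      (Int.natAbs ((W : ℤ) * ((x.val : ℤ) + k.1 * N') + ((b k.2.1 : ℤ) - b k.2.2)))) ≤ 24 * E * N' := by
    intro k hk
    have hℓ : k.1 = -2 ∨ k.1 = -1 ∨ k.1 = 0 ∨ k.1 = 1 := mem_corrLiftSet.mp (Finset.mem_product.mp hk).1
    have hΔ : |((b k.2.1 : ℤ) - b k.2.2)| < W := by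
      obtain ⟨h1, h2⟩ := hb k.2.1
      obtain ⟨h3, h4⟩ := hb k.2.2
      rw [abs_lt]; constructor <;> omega
    rw [Literature.NumberTheory.LFunctions.sum_zmod_eq_sum_range]
    have hval : ∀ v ∈ range N', Real.exp (q' * roughSum w
        (Int.natAbs ((W : ℤ) * ((((v : ℕ) : ZMod N').val : ℤ) + k.1 * N') + ((b k.2.1 : ℤ) - b k.2.2)))) =
        Real.exp (q' * roughSum w (Int.natAbs ((W : ℤ) * (v + k.1 * N') + ((b k.2.1 : ℤ) - b k.2.2)))) := by
      intro v hv
      rw [ZMod.val_natCast_of_lt (Finset.mem_range.mp hv)]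
    rw [Finset.sum_congr rfl hval]
    exact sum_exp_roughSum_lift_le hq'0 hww hw' hW hN'1 hWw hWN hW3 hΔ hℓ
  -- Step 3: sum over `x`, swap, and evaluate
  have ht0 : (0 : ℝ) < 4 * (t : ℝ) ^ 2 := by
    have : (1 : ℝ) ≤ t := by exact_mod_cast ht
    positivity
  calc (∑ x : ZMod N', corrPairWeight C w b N' x ^ q) / N'
      ≤ (∑ x : ZMod N', (4 * (t : ℝ) ^ 2) ^ (q - 1) * ∑ k ∈ corrPairIndex t, Real.exp (q' * roughSum w
          (Int.natAbs ((W : ℤ) * ((x.val : ℤ) + k.1 * N') + ((b k.2.1 : ℤ) - b k.2.2))))) / N' :=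
        div_le_div_of_nonneg_right (Finset.sum_le_sum fun x _ => hpm x) hN'0.le
    _ = (4 * (t : ℝ) ^ 2) ^ (q - 1) * (∑ k ∈ corrPairIndex t, ∑ x : ZMod N', Real.exp (q' * roughSum w
          (Int.natAbs ((W : ℤ) * ((x.val : ℤ) + k.1 * N') + ((b k.2.1 : ℤ) - b k.2.2))))) / N' := by
        rw [← Finset.mul_sum, Finset.sum_comm]
    _ ≤ (4 * (t : ℝ) ^ 2) ^ (q - 1) * (∑ k ∈ corrPairIndex t, 24 * E * N') / N' := by
        refine div_le_div_of_nonneg_right ?_ hN'0.le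
        exact mul_le_mul_of_nonneg_left (Finset.sum_le_sum hfam) (by positivity)
    _ = (4 * (t : ℝ) ^ 2) ^ (q - 1) * (4 * (t : ℝ) ^ 2) * (24 * E) := by
        rw [Finset.sum_const, nsmul_eq_mul, hcardI]
        field_simp
    _ = (4 * (t : ℝ) ^ 2) ^ q * (24 * E) := by
        rw [Real.rpow_sub_one ht0.ne']
        field_simp
    _ ≤ (4 * (t : ℝ) ^ 2) ^ q * (24 * Real.exp (q * C * wq)) := by
        refine mul_le_mul_of_nonneg_left ?_ (by positivity)
        linarith

end Literature.NumberTheory.Sieve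

end
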